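import Summits.ResolutionOfSingularities.ResolutionOfSingularities.Theorems.EquisingularLiftEquisingularLiftNatAxisStalks
import HarnessLib

/-!
# [OURS · L1 W4.5(b) · EL♮(3)] HSUB(ReachTC⁺) brick `inv_base`, part 2f (T-AXIS-QUOTIENT): the quotient of `𝒪_{X₁,p_c}` by the axis
# ideal is `≅ O` (the binder `eO` of res-D-pv-051's `exists_axisSection`, p542434)

Crux chain w45b (cell `res-hironaka`, slot W4.5(b)), working crux **EL♮** = stmt-ResolutionOfSingularities-20038, child **EL♮(3)** =
stmt-ResolutionOfSingularities-20148, route EquisingularLift, line `sections`, registered stub `stub_elnat_tcPlusPointResolution`;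
assembly HSUB(ReachTC⁺)₃ (INV DEFS v3 p532383; brick `inv_base`, CENTRED members). HONEST FRAMING: OURS; NOT a statement of any
manuscript; AI-written, weaker than expert review. No `sorry`; standard axioms. `--supports stmt-ResolutionOfSingularities-20148 --as helper`.

WHAT. res-D-pv-051 (STATUS 2026-08-27T15:18:58Z) needs `(𝒪_{X₁,p_c} ⧸ (C_axis)_{p_c}) ≃+* O`, not merely «regular» (T-AXIS-STALKS (2),
p542871): **`exists_axis_quotient_ringEquiv`** — in the binders of `axis_stalks` plus `θ : R/(c) ≃+* O` (`O` a DVR) and a witness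
`ϖ_R ∈ 𝔪_R ∖ (c)`: the chart quotient `B/𝔞 ≅ (R/(c))[T]/(T) ≅ R/(c) ≅ O` is LOCAL, the image of `𝔔₁` is its maximal ideal (it is a
non-zero prime of a DVR: it contains `ϖ_R/1 ∉ 𝔞`), so the localisation `𝒪_{X₁,p_c}/𝔞·𝒪 = (B/𝔞)_{𝔔₁/𝔞}` (Mathlib: quotients of
localisations are localisations) is `B/𝔞` itself (`IsLocalization.atUnits`), `≅ O`.
-/

set_option linter.dupNamespace false -- mandated namespace `Summit.<Summit>.<Problem>` of this single-conjunct summit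

noncomputable section

open CategoryTheory CategoryTheory.Limits AlgebraicGeometry TopologicalSpace IsLocalRing
open Literature.AlgebraicGeometry.Resolution
open AlgebraicGeometry.Scheme.IdealSheafData

namespace Summit.ResolutionOfSingularities.ResolutionOfSingularities.Cruxes.EquisingularLiftNat.Sections

universe u

section Ring

variable {R : Type u} [CommRing R] (c : Fin 3 → R)

set_option synthInstance.maxHeartbeats 200000 in -- instances on the double quotient of the chart algebra (subalgebra of a localisation)
set_option maxHeartbeats 1600000 in -- idem: defeq checks through four stacked equivalences of quotient rings
/-- **`R[I/c₀]/(c₀/1, c₁/c₀, c₂/c₀) ≅ R/(c)`, compatibly with `R`** (tree `blowupAlgebraQuotEquiv`, `MvPolynomial.quotientSpanXEquiv`,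
`MvPolynomial.isEmptyAlgEquiv`). [cite: StacksProject, Tag 0BIQ] -/
theorem exists_blowupAlgebra_quotient_axis_ringEquiv (hc : IsQuasiRegular c) :
    ∃ e : (blowupAlgebra (Ideal.span (Set.range c)) (c 0) ⧸
        (Ideal.span {algebraMap R (blowupAlgebra (Ideal.span (Set.range c)) (c 0)) (c 0)} ⊔
          Ideal.span {blowupAlgebra.frac c 0 1, blowupAlgebra.frac c 0 2})) ≃+* (R ⧸ Ideal.span (Set.range c)),
      ∀ r : R, e (Ideal.Quotient.mk _ (algebraMap R _ r)) = Ideal.Quotient.mk _ r := by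
  let e₁ : (blowupAlgebra (Ideal.span (Set.range c)) (c 0) ⧸
      Ideal.span {algebraMap R (blowupAlgebra (Ideal.span (Set.range c)) (c 0)) (c 0)}) ≃+*
      MvPolynomial {j : Fin 3 // j ≠ 0} (R ⧸ Ideal.span (Set.range c)) := (blowupAlgebraQuotEquiv c 0 hc).symm
  have he₁ : ∀ j : {j : Fin 3 // j ≠ 0}, e₁ (Ideal.Quotient.mk _ (blowupAlgebra.frac c 0 j.1)) = MvPolynomial.X j := fun j => by
    change (blowupAlgebraQuotEquiv c 0 hc).symm _ = _
    rw [RingEquiv.symm_apply_eq, blowupAlgebraQuotEquiv_X]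
  have he₁C : ∀ r : R, e₁ (Ideal.Quotient.mk _ (algebraMap R _ r)) = MvPolynomial.C (Ideal.Quotient.mk _ r) := fun r => by
    change (blowupAlgebraQuotEquiv c 0 hc).symm _ = _
    rw [RingEquiv.symm_apply_eq, blowupAlgebraQuotEquiv_C]
  have himg : Ideal.span (MvPolynomial.X '' (Set.univ : Set {j : Fin 3 // j ≠ 0}) :
      Set (MvPolynomial {j : Fin 3 // j ≠ 0} (R ⧸ Ideal.span (Set.range c)))) =
      ((Ideal.span {blowupAlgebra.frac c 0 1, blowupAlgebra.frac c 0 2}).map (Ideal.Quotient.mk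
        (Ideal.span {algebraMap R (blowupAlgebra (Ideal.span (Set.range c)) (c 0)) (c 0)}))).map e₁.toRingHom := by
    rw [X_image_univ_eq, Ideal.map_map, Ideal.map_span, Set.image_pair]
    congr 1
    change _ = {e₁ (Ideal.Quotient.mk _ _), e₁ (Ideal.Quotient.mk _ _)}
    rw [he₁ ⟨1, by decide⟩, he₁ ⟨2, by decide⟩]
  haveI : IsEmpty {j : {j : Fin 3 // j ≠ 0} // j ∉ (Set.univ : Set {j : Fin 3 // j ≠ 0})} :=
    ⟨fun j => j.2 (Set.mem_univ _)⟩
  let E2 := DoubleQuot.quotQuotEquivQuotSup (Ideal.span {algebraMap R (blowupAlgebra (Ideal.span (Set.range c)) (c 0)) (c 0)})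
    (Ideal.span {blowupAlgebra.frac c 0 1, blowupAlgebra.frac c 0 2})
  let E3 := Ideal.quotientEquiv _ _ e₁ himg
  let E4 := (MvPolynomial.quotientSpanXEquiv (R := R ⧸ Ideal.span (Set.range c)) (Set.univ : Set {j : Fin 3 // j ≠ 0})).toRingEquiv
  let E5 := (MvPolynomial.isEmptyAlgEquiv (R ⧸ Ideal.span (Set.range c))
    {j : {j : Fin 3 // j ≠ 0} // j ∉ (Set.univ : Set {j : Fin 3 // j ≠ 0})}).toRingEquiv
  refine ⟨E2.symm.trans (E3.trans (E4.trans E5)), fun r => ?_⟩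
  have h2 : E2.symm (Ideal.Quotient.mk _ (algebraMap R _ r)) =
      Ideal.Quotient.mk _ (Ideal.Quotient.mk _ (algebraMap R (blowupAlgebra (Ideal.span (Set.range c)) (c 0)) r)) :=
    DoubleQuot.quotQuotEquivQuotSup_symm_quotQuotMk _ _ _
  have h3 : E3 (Ideal.Quotient.mk _ (Ideal.Quotient.mk _ (algebraMap R (blowupAlgebra (Ideal.span (Set.range c)) (c 0)) r))) =
      Ideal.Quotient.mk _ (MvPolynomial.C (Ideal.Quotient.mk _ r)) := by
    change Ideal.quotientEquiv _ _ e₁ himg (Ideal.Quotient.mk _ _) = _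
    rw [Ideal.quotientEquiv_mk]
    exact congrArg _ (he₁C r)
  have h4 : E4 (Ideal.Quotient.mk _ (MvPolynomial.C (Ideal.Quotient.mk _ r))) = MvPolynomial.C (Ideal.Quotient.mk _ r) :=
    MvPolynomial.quotientSpanXEquiv_mk_C _ _
  have h5 : E5 (MvPolynomial.C (Ideal.Quotient.mk (Ideal.span (Set.range c)) r)) = Ideal.Quotient.mk _ r := by
    change MvPolynomial.isEmptyAlgEquiv _ _ (algebraMap (R ⧸ Ideal.span (Set.range c)) _ (Ideal.Quotient.mk _ r)) = _
    rw [AlgEquiv.commutes]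
    rfl
  calc (E2.symm.trans (E3.trans (E4.trans E5))) (Ideal.Quotient.mk _ (algebraMap R _ r))
      = E5 (E4 (E3 (E2.symm (Ideal.Quotient.mk _ (algebraMap R _ r))))) := rfl
    _ = Ideal.Quotient.mk _ r := by rw [h2, h3, h4, h5]

end Ring

/-! ## Generic: quotients of localisations by ideals with local PID quotient -/

section Generic

/-- **A prime over `𝔞` whose image in `B/𝔞 ≅ Λ` (a local PID, e.g. a DVR) is non-zero pulls back the maximal ideal:**
`e(b̄) ∈ 𝔪_Λ ⇒ b ∈ 𝔔` (the image of `𝔔` is a non-zero prime of `Λ`, hence maximal). [folklore] -/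
theorem forall_mem_of_ringEquiv_apply_mem_maximalIdeal {B Λ : Type*} [CommRing B] [CommRing Λ] [IsLocalRing Λ]
    [IsDomain Λ] [IsPrincipalIdealRing Λ] (𝔔 : Ideal B) [𝔔.IsPrime] (𝔞 : Ideal B) (h𝔞𝔔 : 𝔞 ≤ 𝔔)
    (e : (B ⧸ 𝔞) ≃+* Λ) (hne : ∃ b ∈ 𝔔, e (Ideal.Quotient.mk 𝔞 b) ≠ 0) :
    ∀ b, e (Ideal.Quotient.mk 𝔞 b) ∈ maximalIdeal Λ → b ∈ 𝔔 := by
  haveI hprime : (𝔔.map (Ideal.Quotient.mk 𝔞)).IsPrime :=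
    Ideal.map_isPrime_of_surjective Ideal.Quotient.mk_surjective (by rw [Ideal.mk_ker]; exact h𝔞𝔔)
  haveI hP : ((𝔔.map (Ideal.Quotient.mk 𝔞)).map e).IsPrime := Ideal.map_isPrime_of_equiv e
  have hP0 : (𝔔.map (Ideal.Quotient.mk 𝔞)).map e ≠ ⊥ := by
    obtain ⟨b₀, hb₀, hb₀e⟩ := hne
    intro h0
    have hmem : e (Ideal.Quotient.mk 𝔞 b₀) ∈ (𝔔.map (Ideal.Quotient.mk 𝔞)).map e :=
      Ideal.mem_map_of_mem _ (Ideal.mem_map_of_mem _ hb₀)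
    rw [h0, Ideal.mem_bot] at hmem
    exact hb₀e hmem
  have hPmax : ((𝔔.map (Ideal.Quotient.mk 𝔞)).map e).IsMaximal := IsPrime.to_maximal_ideal hP0
  have hPeq : (𝔔.map (Ideal.Quotient.mk 𝔞)).map e = maximalIdeal Λ := IsLocalRing.eq_maximalIdeal hPmax
  intro b hb
  rw [← hPeq] at hb
  have h1 : Ideal.Quotient.mk 𝔞 b ∈ 𝔔.map (Ideal.Quotient.mk 𝔞) := by
    rw [← Ideal.comap_map_of_bijective e e.bijective (I := 𝔔.map (Ideal.Quotient.mk 𝔞)), Ideal.mem_comap]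
    exact hb
  have h2 : b ∈ (𝔔.map (Ideal.Quotient.mk 𝔞)).comap (Ideal.Quotient.mk 𝔞) := Ideal.mem_comap.mpr h1
  rw [Ideal.comap_map_of_surjective _ Ideal.Quotient.mk_surjective] at h2
  obtain ⟨y, hy, z, hz, hyz⟩ := Submodule.mem_sup.mp h2
  rw [← hyz]
  refine 𝔔.add_mem hy (h𝔞𝔔 ?_)
  rw [Ideal.mem_comap, Ideal.mem_bot, Ideal.Quotient.eq_zero_iff_mem] at hz
  exact hz


/-- **Localisation commutes with quotients — the trivial-localisation case.** `S` a localisation of `B` at the prime `𝔔`,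
`e : B/𝔞 ≅ Λ` with `Λ` local and `e⁻¹(𝔪_Λ)` pulling back into `𝔔`: then `S/𝔞S ≅ Λ`, compatibly with `B` (Mathlib: `S/𝔞S` is the
localisation of `B/𝔞` at the image of `B ∖ 𝔔`, which consists of units; `IsLocalization.atUnits`). [folklore] -/
theorem exists_quotient_map_ringEquiv_of_isLocalization {B S Λ : Type*} [CommRing B] [CommRing S] [Algebra B S]
    [CommRing Λ] [IsLocalRing Λ]
    (𝔔 : Ideal B) [𝔔.IsPrime] [IsLocalization.AtPrime S 𝔔] (𝔞 : Ideal B)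
    (e : (B ⧸ 𝔞) ≃+* Λ) (hmax : ∀ b, e (Ideal.Quotient.mk 𝔞 b) ∈ maximalIdeal Λ → b ∈ 𝔔) :
    ∃ ε : (S ⧸ 𝔞.map (algebraMap B S)) ≃+* Λ,
      ∀ b, ε (Ideal.Quotient.mk _ (algebraMap B S b)) = e (Ideal.Quotient.mk 𝔞 b) := by
  have H : Algebra.algebraMapSubmonoid (B ⧸ 𝔞) 𝔔.primeCompl ≤ IsUnit.submonoid (B ⧸ 𝔞) := by
    rintro _ ⟨b, hb, rfl⟩
    rw [IsUnit.mem_submonoid_iff]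
    by_contra hnu
    refine hb (hmax b ((IsLocalRing.mem_maximalIdeal _).mpr fun hu => hnu ?_))
    simpa using hu.map e.symm
  let eL : (B ⧸ 𝔞) ≃ₐ[B ⧸ 𝔞] (S ⧸ 𝔞.map (algebraMap B S)) := IsLocalization.atUnits _ _ H
  refine ⟨eL.toRingEquiv.symm.trans e, fun b => ?_⟩
  rw [RingEquiv.trans_apply]
  congr 1
  rw [RingEquiv.symm_apply_eq]
  change _ = eL (algebraMap (B ⧸ 𝔞) (B ⧸ 𝔞) (Ideal.Quotient.mk 𝔞 b))
  rw [eL.commutes]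
  rfl

end Generic

/-! ## Stalk level: `𝒪_{X₁,p_c} / (C_axis)_{p_c} ≅ O` -/

section Stalk

variable (O : Type) [CommRing O] [IsDomain O] [IsDiscreteValuationRing O]

set_option maxHeartbeats 800000 in -- chart-algebra presentation plus the quotient-of-a-localisation instance (cf. p542871)
/-- **T-AXIS-QUOTIENT: `𝒪_{X₁,p_c}/(C_axis)_{p_c} ≅ O`, compatibly with `R = 𝒪_{X′,p}`** (the binder `eO` of res-D-pv-051's
`exists_axisSection`). In the binders of `axis_stalks` (T-AXIS-STALKS, p542871) together with `θ : R/(c) ≃+* O` and an element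
`ϖ_R ∈ 𝔪_R ∖ (c)` (the germ of the uniformizer): the quotient of the local ring at the cone point by the axis ideal is isomorphic to `O`,
the class of `τ₁^♯ r` going to `θ r̄`. See the module docstring. [cite: StacksProject, Tag 0BIQ] -/
theorem exists_axis_quotient_ringEquiv {X' X₁ : Scheme.{0}} [IsLocallyNoetherian X₁] {J : X'.IdealSheafData} {τ₁ : X₁ ⟶ X'}
    (L₁ L₂ : X'.IdealSheafData) (p₁ : X₁) (p : X') (hpc : τ₁ p₁ = p) (hpJ : p ∈ (J.support : Set X'))
    (c : Fin 3 → X'.presheaf.stalk p) (hcJ : Ideal.span (Set.range c) = stalkIdeal J p) (hc : IsQuasiRegular c)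
    [IsDomain (X'.presheaf.stalk p ⧸ Ideal.span (Set.range c))]
    (θ : (X'.presheaf.stalk p ⧸ Ideal.span (Set.range c)) ≃+* O) (ϖR : X'.presheaf.stalk p)
    (hϖR𝔪 : ϖR ∈ maximalIdeal (X'.presheaf.stalk p)) (hϖRc : ϖR ∉ Ideal.span (Set.range c))
    (hL₁ : stalkIdeal L₁ p = Ideal.span {c 1}) (hL₂ : stalkIdeal L₂ p = Ideal.span {c 2})
    (𝔔₁ : PrimeSpectrum (blowupAlgebra (Ideal.span (Set.range c)) (c 0)))
    (χ₁ : blowupAlgebra (Ideal.span (Set.range c)) (c 0) →+* X₁.presheaf.stalk p₁)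
    (hχ₁ : ∀ a, χ₁ (algebraMap _ _ a) = ((X'.presheaf.stalkCongr (Inseparable.of_eq hpc)).inv ≫ τ₁.stalkMap p₁).hom a)
    (hloc₁ : @IsLocalization.AtPrime _ _ (X₁.presheaf.stalk p₁) _ χ₁.toAlgebra 𝔔₁.asIdeal _)
    (h𝔔₁ : 𝔔₁.asIdeal.comap (algebraMap _ (blowupAlgebra (Ideal.span (Set.range c)) (c 0))) = maximalIdeal (X'.presheaf.stalk p))
    (hu : ∀ l : Fin 3, l ≠ 0 → χ₁ (blowupAlgebra.frac c 0 l) ∈ maximalIdeal (X₁.presheaf.stalk p₁)) :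
    ∃ ε : (X₁.presheaf.stalk p₁ ⧸
      stalkIdeal ((J.comap τ₁ ⊔ strictTransformIdeal τ₁ J L₁) ⊔ strictTransformIdeal τ₁ J L₂) p₁) ≃+* O,
      ∀ r, ε (Ideal.Quotient.mk _ (((X'.presheaf.stalkCongr (Inseparable.of_eq hpc)).inv ≫ τ₁.stalkMap p₁).hom r)) =
        θ (Ideal.Quotient.mk _ r) := by
  letI := χ₁.toAlgebra
  haveI : IsLocalization.AtPrime (X₁.presheaf.stalk p₁) 𝔔₁.asIdeal := hloc₁
  haveI : IsRegularRing (X'.presheaf.stalk p ⧸ Ideal.span (Set.range c)) := IsRegularRing.of_ringEquiv θ.symm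
  obtain ⟨h1, -⟩ := axis_stalks L₁ L₂ p₁ p hpc hpJ c hcJ hc hL₁ hL₂ 𝔔₁ χ₁ hχ₁ hloc₁ h𝔔₁ hu
  obtain ⟨e𝔞, he𝔞⟩ := exists_blowupAlgebra_quotient_axis_ringEquiv c hc
  have h𝔞𝔔 : Ideal.span {algebraMap _ (blowupAlgebra (Ideal.span (Set.range c)) (c 0)) (c 0)} ⊔
      Ideal.span {blowupAlgebra.frac c 0 1, blowupAlgebra.frac c 0 2} ≤ 𝔔₁.asIdeal := by
    refine sup_le ((Ideal.span_singleton_le_iff_mem _).mpr ?_) ?_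
    · rw [← Ideal.mem_comap, h𝔔₁]
      have h := (mem_support_iff_stalkIdeal_le J p).mp hpJ
      rw [← hcJ] at h
      exact h (Ideal.subset_span (Set.mem_range_self 0))
    · rw [Ideal.span_le]
      rintro b (rfl | rfl)
      · exact (IsLocalization.AtPrime.to_map_mem_maximal_iff (X₁.presheaf.stalk p₁) 𝔔₁.asIdeal _).mp (hu 1 (by decide))
      · exact (IsLocalization.AtPrime.to_map_mem_maximal_iff (X₁.presheaf.stalk p₁) 𝔔₁.asIdeal _).mp (hu 2 (by decide))
  have hϖ𝔔 : algebraMap _ (blowupAlgebra (Ideal.span (Set.range c)) (c 0)) ϖR ∈ 𝔔₁.asIdeal := by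
    rw [← Ideal.mem_comap, h𝔔₁]; exact hϖR𝔪
  have hne : ∃ b ∈ 𝔔₁.asIdeal, (e𝔞.trans θ) (Ideal.Quotient.mk _ b) ≠ 0 := by
    refine ⟨_, hϖ𝔔, fun h0 => hϖRc ?_⟩
    rw [RingEquiv.trans_apply, he𝔞, map_eq_zero_iff _ θ.injective] at h0
    exact Ideal.Quotient.eq_zero_iff_mem.mp h0
  have hmax := forall_mem_of_ringEquiv_apply_mem_maximalIdeal 𝔔₁.asIdeal _ h𝔞𝔔 (e𝔞.trans θ) hne
  obtain ⟨ε, hε⟩ := exists_quotient_map_ringEquiv_of_isLocalization (S := X₁.presheaf.stalk p₁) 𝔔₁.asIdeal _ (e𝔞.trans θ) hmax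
  refine ⟨(Ideal.quotEquivOfEq h1).trans ε, fun r => ?_⟩
  rw [RingEquiv.trans_apply, ← hχ₁, Ideal.quotEquivOfEq_mk]
  exact (hε _).trans (by rw [RingEquiv.trans_apply, he𝔞])

end Stalk

end Summit.ResolutionOfSingularities.ResolutionOfSingularities.Cruxes.EquisingularLiftNat.Sections

end
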